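import Mathlib
import Summits.ValiantsHypothesis.ValiantsHypothesis.Theorems.BinomialElusiveBinomialCandidatePolarImmersiveAtInfinity
import Summits.ValiantsHypothesis.ValiantsHypothesis.Theorems.BinomialElusiveBinomialCandidateInfinityCommonZero
import Summits.ValiantsHypothesis.ValiantsHypothesis.Theorems.BinomialElusiveBinomialCandidateInfinityStepTwo

/-!
# Crux `BinomialElusive.BinomialCandidate` (stmt-ValiantsHypothesis-7392), line `registered`,
# skeleton v4 — stub `stub_infinityStepTwoImproper`: the second peeling step at the place over
# `x = ∞`, improper branch (all quadratic parts vanish at the pole direction)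

The registered stub `stub_infinityStepTwoImproper` of the crux
`Summit.ValiantsHypothesis.ValiantsHypothesis.Theses.BinomialElusive.BinomialCandidate`.
Data: a quadratic `Γ : ℂ^s → ℂ^m` (`totalDegree (Γ i) ≤ 2`), `N ≥ 1`, `a i < b i`, `b` injective,
a formal Laurent solution `p` of `Γ_i(p) = t^{-N a_i} + t^{-N b_i}` with least order `μ < 0`, pole
direction `z = (p_j.coeff μ)_j ≠ 0`, and `B_i(z) = 0` for ALL `i`
(`B_i = homogeneousComponent 2 (Γ i)`, `L_i = homogeneousComponent 1 (Γ i)`).  Claim (dichotomy):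
EITHER there are a second direction `z' ∉ ℂ z` and an index `i₁` with `Σ_j z'_j ∂_jB_i(z) = 0` for
all `i ≠ i₁`, OR there are a point `w` and an index `i₁` with `Σ_j z_j (∂_jΓ_i)(w) = 0` for all
`i ≠ i₁`.

**The v4-registered signature was mis-stated for `m = 0`:** both disjuncts assert `∃ i₁ : Fin m`,
while for `m = 0`, `s = 1`, `N = 1`, `μ = -1`, `p 0 = t⁻¹` every hypothesis holds (vacuously in
`i`).  This file proves the statement with the extra hypothesis `0 < m` (inserted right after the
binder `(μ : ℤ)`), which the composition in the skeleton has at hand (`hmpos : 0 < m`).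

Proof (lowest-order calculus in the chart at infinity, as in the sibling stub
`stub_infinityStepTwo`).  Pick `j₀` with `z_{j₀} ≠ 0`, normalise `Λ = z_{j₀}⁻¹ p_{j₀}` (no
coefficients below `μ`, coefficient `1` at `μ`), and put `q j = Λ⁻¹ p j`: `p j = Λ q j`, `q j` has
no pole, `(q j)(0) = z j`, `q j₀ = z j₀` is constant, `w j = q j - z j` has positive order.  Let
`o ≥ 1` be the least exponent that carries a nonzero coefficient of some `w j` or equals `-μ`, and
`v j = (w j).coeff o` (so `v j₀ = 0`).  Each `q j` is the jet `z j + v j t^o`, and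
`Γ_i(p) = K_i + Λ L_i(q) + Λ² B_i(q)` has no coefficients below `2μ + o ≤ μ`
(`InfinityStepTwo.coeff_aeval_of_jet`).  Compare with the target `t^{-N a_i} + t^{-N b_i}`, whose
only coefficients are `1` at `-N b_i < -N a_i` (`InfinityCommonZero.le_and_eq_zero_or_eq`); by
injectivity of `b` an equation `ν = -N b_i` holds for at most one index `i₁`.

* `o < -μ` (the remainder `r = Λ w` has a pole): the coefficient of `Γ_i(p)` at `2μ + o` is
  `Σ_j v_j ∂_jB_i(z)`, nonzero only if `2μ + o = -N b_i`; and `v ≠ 0`, `v j₀ = 0 ≠ z j₀` give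
  `v ∉ ℂ z`.  First disjunct with `z' = v`.
* `o = -μ` (the remainder is integral, with value `v`): the coefficient of `Γ_i(p)` at `μ` is
  `L_i(z) + Σ_j v_j ∂_jB_i(z)` (`InfinityStepTwoImproper.coeff_aeval_of_jet_top`), nonzero only if
  `μ = -N b_i`; and `L_i(z) + Σ_j v_j ∂_jB_i(z) = Σ_j z_j (∂_jΓ_i)(v)` by Euler's identity for the
  linear part and the symmetry of the polarisation `Σ_j z_j (∂_jB)(v) = Σ_j v_j (∂_jB)(z)` of the
  quadratic part (`InfinityStepTwoImproper.sum_mul_eval_pderiv_eq`, from Mathlib's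
  `MvPolynomial.IsHomogeneous.sum_X_mul_pderiv`).  Second disjunct with `w = v`.

Mathlib only, plus the tree files imported above (`PolarPeeling.*`, `PolarImmersive.*`,
`InfinityCommonZero.*`, `InfinityStepTwo.coeff_aeval_of_jet`).
-/

-- layout Summits/ValiantsHypothesis/ValiantsHypothesis forces the duplicated namespace component
set_option linter.dupNamespace false

namespace Summit.ValiantsHypothesis.ValiantsHypothesis.Theorems.BinomialCandidateStubs

open scoped BigOperators

namespace InfinityStepTwoImproper

/-! ## Euler's identity and the symmetry of the polarisation -/

/-- A homogeneous polynomial of degree `0` is a constant: its value does not depend on the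
point. -/
theorem eval_eq_eval_of_isHomogeneous_zero {k : ℕ} {ψ : MvPolynomial (Fin k) ℂ}
    (hψ : ψ.IsHomogeneous 0) (u z : Fin k → ℂ) :
    MvPolynomial.eval u ψ = MvPolynomial.eval z ψ := by
  rw [MvPolynomial.totalDegree_eq_zero_iff_eq_C.mp
    ((MvPolynomial.totalDegree_zero_iff_isHomogeneous _).mpr hψ), MvPolynomial.eval_C,
    MvPolynomial.eval_C]

/-- **Euler for linear forms**: `Σ_j z_j (∂_jL)(u) = L(z)` for `L` homogeneous of degree `1`
(its partial derivatives are constants). -/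
theorem sum_mul_eval_pderiv_of_isHomogeneous_one {k : ℕ} {L : MvPolynomial (Fin k) ℂ}
    (hL : L.IsHomogeneous 1) (z u : Fin k → ℂ) :
    ∑ j, z j * MvPolynomial.eval u (MvPolynomial.pderiv j L) = MvPolynomial.eval z L := by
  have h := congrArg (MvPolynomial.eval z) hL.sum_X_mul_pderiv
  rw [map_sum, one_smul] at h
  rw [← h]
  refine Finset.sum_congr rfl fun j _ => ?_
  rw [map_mul, MvPolynomial.eval_X, eval_eq_eval_of_isHomogeneous_zero hL.pderiv u z]

/-- Partial derivatives commute. -/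
theorem pderiv_pderiv_comm {k : ℕ} (i j : Fin k) (φ : MvPolynomial (Fin k) ℂ) :
    MvPolynomial.pderiv i (MvPolynomial.pderiv j φ) =
      MvPolynomial.pderiv j (MvPolynomial.pderiv i φ) := by
  -- adapted from Literature/Algebra/Polynomial/FischerInnerProduct `pderiv_pderiv_comm`
  induction φ using MvPolynomial.induction_on with
  | C a => simp
  | add p q hp hq => simp [map_add, hp, hq]
  | mul_X p l h =>
    simp only [MvPolynomial.pderiv_mul, map_add, h, MvPolynomial.pderiv_X]
    by_cases hil : i = l <;> by_cases hjl : j = l <;> simp [hil, hjl]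

/-- **Symmetry of the polarisation**: `Σ_j z_j (∂_jB)(u) = Σ_j u_j (∂_jB)(z)` for `B` homogeneous
of degree `2` (both are `Σ_{j,l} z_j u_l ∂_j∂_lB`). -/
theorem sum_mul_eval_pderiv_comm {k : ℕ} {B : MvPolynomial (Fin k) ℂ} (hB : B.IsHomogeneous 2)
    (z u : Fin k → ℂ) :
    ∑ j, z j * MvPolynomial.eval u (MvPolynomial.pderiv j B) =
      ∑ j, u j * MvPolynomial.eval z (MvPolynomial.pderiv j B) := by
  -- the `∂_jB` are linear forms: `(∂_jB)(y) = Σ_l y_l (∂_l∂_jB)(z)`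
  have e : ∀ j (y : Fin k → ℂ), MvPolynomial.eval y (MvPolynomial.pderiv j B) =
      ∑ l, y l * MvPolynomial.eval z (MvPolynomial.pderiv l (MvPolynomial.pderiv j B)) :=
    fun j y => (sum_mul_eval_pderiv_of_isHomogeneous_one hB.pderiv y z).symm
  simp_rw [e, Finset.mul_sum]
  rw [Finset.sum_comm]
  refine Finset.sum_congr rfl fun j _ => Finset.sum_congr rfl fun l _ => ?_
  rw [pderiv_pderiv_comm j l B]
  ring

/-- **The differential along the pole direction.**  For `Γ` of total degree `≤ 2` with
homogeneous pieces `K + L + B`: `Σ_j z_j (∂_jΓ)(u) = L(z) + Σ_j u_j (∂_jB)(z)`. -/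
theorem sum_mul_eval_pderiv_eq {k : ℕ} (Γ : MvPolynomial (Fin k) ℂ) (hΓ : Γ.totalDegree ≤ 2)
    (z u : Fin k → ℂ) :
    ∑ j, z j * MvPolynomial.eval u (MvPolynomial.pderiv j Γ) =
      MvPolynomial.eval z (MvPolynomial.homogeneousComponent 1 Γ) +
        ∑ j, u j * MvPolynomial.eval z
          (MvPolynomial.pderiv j (MvPolynomial.homogeneousComponent 2 Γ)) := by
  conv_lhs => rw [PolarImmersive.eq_add_homogeneousComponent Γ hΓ]
  simp only [map_add, MvPolynomial.homogeneousComponent_zero, MvPolynomial.pderiv_C, zero_add,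
    mul_add, Finset.sum_add_distrib]
  rw [sum_mul_eval_pderiv_of_isHomogeneous_one (MvPolynomial.homogeneousComponent_isHomogeneous 1 Γ),
    sum_mul_eval_pderiv_comm (MvPolynomial.homogeneousComponent_isHomogeneous 2 Γ)]

/-! ## The top coefficient in the integral branch -/

/-- **Orders after the first peeling step at infinity, integral remainder.**  Let `0 < o = -μ`,
let `Λ` have no coefficients below `μ` and coefficient `1` at `μ`, let every `q j` be the jet
`z j + v j t^o`, and let `Γ` (`totalDegree ≤ 2`) have homogeneous pieces `K + L + B` with
`B(z) = 0`.  Then the coefficient of `Γ(Λ q) = K + Λ L(q) + Λ² B(q)` at `μ = 2μ + o` is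
`L(z) + Σ_j v_j ∂_jB(z)`. -/
theorem coeff_aeval_of_jet_top {k : ℕ} {o μ : ℤ} (ho : 0 < o) (hoμ : o = -μ) (Λ : LaurentSeries ℂ)
    (hΛ : ∀ g < μ, Λ.coeff g = 0) (hΛμ : Λ.coeff μ = 1)
    (q : Fin k → LaurentSeries ℂ) (z v : Fin k → ℂ)
    (hq : ∀ j, ∀ g ≤ o, (q j).coeff g = (if g = 0 then z j else 0) + if g = o then v j else 0)
    (Γ : MvPolynomial (Fin k) ℂ) (hΓ : Γ.totalDegree ≤ 2)
    (hB : MvPolynomial.eval z (MvPolynomial.homogeneousComponent 2 Γ) = 0) :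
    (MvPolynomial.aeval (fun j => Λ * q j) Γ).coeff μ =
      MvPolynomial.eval z (MvPolynomial.homogeneousComponent 1 Γ) +
        ∑ j, v j * MvPolynomial.eval z
          (MvPolynomial.pderiv j (MvPolynomial.homogeneousComponent 2 Γ)) := by
  -- adapted from `InfinityStepTwo.coeff_aeval_of_jet`
  set K := MvPolynomial.homogeneousComponent 0 Γ
  set L := MvPolynomial.homogeneousComponent 1 Γ
  set B := MvPolynomial.homogeneousComponent 2 Γ
  -- the identity `Γ(Λ q) = K(q) + Λ L(q) + Λ² B(q)`
  have e : ∀ n, MvPolynomial.aeval (fun j => Λ * q j) (MvPolynomial.homogeneousComponent n Γ) =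
      Λ ^ n * MvPolynomial.aeval q (MvPolynomial.homogeneousComponent n Γ) := fun n =>
    PolarImmersive.aeval_mul_of_isHomogeneous _
      (MvPolynomial.homogeneousComponent_isHomogeneous n Γ) Λ q
  have hT : MvPolynomial.aeval (fun j => Λ * q j) Γ =
      MvPolynomial.aeval q K + Λ * MvPolynomial.aeval q L + Λ * Λ * MvPolynomial.aeval q B := by
    conv_lhs => rw [PolarImmersive.eq_add_homogeneousComponent Γ hΓ, map_add, map_add, e 0, e 1,
      e 2]
    ring
  -- the pieces in the chart: `K(q)`, `L(q)` have no pole, `L(q)(0) = L(z)`, and `B(q)` is the jet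
  -- `0 + (Σ v ∂B(z)) t^o`
  have hK0 : ∀ g < 0, (MvPolynomial.aeval q K).coeff g = 0 := fun g hg => by
    rw [PolarImmersive.jet_aeval ho hq K g (by omega), if_neg hg.ne, if_neg (by omega), add_zero]
  have hL0 : ∀ g < 0, (MvPolynomial.aeval q L).coeff g = 0 := fun g hg => by
    rw [PolarImmersive.jet_aeval ho hq L g (by omega), if_neg hg.ne, if_neg (by omega), add_zero]
  have hLz : (MvPolynomial.aeval q L).coeff 0 = MvPolynomial.eval z L :=
    PolarImmersive.jet_coeff_zero (PolarImmersive.jet_aeval ho hq L) ho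
  have hB0 : ∀ g < o, (MvPolynomial.aeval q B).coeff g = 0 := fun g hg => by
    rw [PolarImmersive.jet_aeval ho hq B g hg.le, if_neg hg.ne, add_zero]
    split_ifs
    · exact hB
    · rfl
  have hBo : (MvPolynomial.aeval q B).coeff o =
      ∑ j, v j * MvPolynomial.eval z (MvPolynomial.pderiv j B) := by
    rw [PolarImmersive.jet_aeval ho hq B o le_rfl, if_neg ho.ne', if_pos rfl, zero_add]
  have hΛΛ : ∀ g < μ + μ, (Λ * Λ).coeff g = 0 := PolarPeeling.coeff_mul_eq_zero_of_lt hΛ hΛ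
  have hΛΛμ : (Λ * Λ).coeff (μ + μ) = 1 := by
    rw [PolarPeeling.coeff_mul_eq hΛ hΛ, hΛμ, mul_one]
  -- the three coefficients at `μ`
  have h1 : (MvPolynomial.aeval q K).coeff μ = 0 := hK0 μ (by omega)
  have h2 : (Λ * MvPolynomial.aeval q L).coeff μ = MvPolynomial.eval z L := by
    have h := PolarPeeling.coeff_mul_eq hΛ hL0
    rwa [add_zero, hΛμ, hLz, one_mul] at h
  have h3 : (Λ * Λ * MvPolynomial.aeval q B).coeff μ =
      ∑ j, v j * MvPolynomial.eval z (MvPolynomial.pderiv j B) := by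
    have h := PolarPeeling.coeff_mul_eq hΛΛ hB0
    rwa [show μ + μ + o = μ by omega, hΛΛμ, hBo, one_mul] at h
  rw [hT, HahnSeries.coeff_add, HahnSeries.coeff_add, h1, h2, h3, zero_add]

end InfinityStepTwoImproper

open InfinityStepTwoImproper in
/-- **Stub `stub_infinityStepTwoImproper`, with the hypothesis `0 < m`** (crux
stmt-ValiantsHypothesis-7392, line `registered`): the second peeling step at the place over `x = ∞`
in the improper branch.  Given `m ≥ 1` and a formal Laurent solution `p` of
`Γ_i(p) = t^{-N a_i} + t^{-N b_i}` (`Γ` quadratic, `N ≥ 1`, `a_i < b_i`, `b` injective) with least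
order `μ < 0`, pole direction `z = (p_j.coeff μ)_j ≠ 0` and `B_i(z) = 0` for all `i`
(`B_i = homogeneousComponent 2 (Γ i)`): either there are a second direction `z' ∉ ℂ z` and an
index `i₁` with `Σ_j z'_j ∂_jB_i(z) = 0` for all `i ≠ i₁`, or there are a point `w` and an index
`i₁` with `Σ_j z_j (∂_jΓ_i)(w) = 0` for all `i ≠ i₁`.  (Without `0 < m` the statement fails: for
`m = 0` both disjuncts need some `i₁ : Fin 0`, while `s = 1`, `p 0 = t⁻¹`, `μ = -1`, `N = 1`
satisfy every hypothesis.) -/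
theorem stub_infinityStepTwoImproper :
    ∀ (m s : ℕ) (a b : Fin m → ℕ) (Γ : Fin m → MvPolynomial (Fin s) ℂ) (N : ℕ) (p : Fin s → LaurentSeries ℂ)
      (μ : ℤ), 0 < m → (∀ i, (Γ i).totalDegree ≤ 2) → 0 < N → (∀ i, a i < b i) → Function.Injective b →
      (∀ i, MvPolynomial.aeval p (Γ i) =
        HahnSeries.single (-((N * a i : ℕ) : ℤ)) (1 : ℂ) + HahnSeries.single (-((N * b i : ℕ) : ℤ)) (1 : ℂ)) →
      μ < 0 → (∀ j, ∀ g < μ, (p j).coeff g = 0) → (fun j => (p j).coeff μ) ≠ 0 →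
      (∀ i, MvPolynomial.eval (fun j => (p j).coeff μ) (MvPolynomial.homogeneousComponent 2 (Γ i)) = 0) →
      (∃ z' : Fin s → ℂ, (∀ c : ℂ, z' ≠ c • (fun j => (p j).coeff μ)) ∧ ∃ i₁ : Fin m, ∀ i, i ≠ i₁ →
          ∑ j, z' j * MvPolynomial.eval (fun l => (p l).coeff μ)
            (MvPolynomial.pderiv j (MvPolynomial.homogeneousComponent 2 (Γ i))) = 0) ∨
      (∃ w : Fin s → ℂ, ∃ i₁ : Fin m, ∀ i, i ≠ i₁ →
          ∑ j, (p j).coeff μ * MvPolynomial.eval w (MvPolynomial.pderiv j (Γ i)) = 0) := by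
  intro m s a b Γ N p μ hm hΓ hN hab hb hsol hμ hp hz hBz
  classical
  -- the exponents of the target: `-N b_i < -N a_i`
  have huv : ∀ i, -((N * b i : ℕ) : ℤ) < -((N * a i : ℕ) : ℤ) := fun i =>
    neg_lt_neg (by exact_mod_cast Nat.mul_lt_mul_of_pos_left (hab i) hN)
  -- "all but at most one index": an equation `ν = -N b_i` singles out at most one `i`
  have hsel : ∀ (P : Fin m → Prop) (ν : ℤ), (∀ i, P i ∨ ν = -((N * b i : ℕ) : ℤ)) →
      ∃ i₁ : Fin m, ∀ i, i ≠ i₁ → P i := by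
    intro P ν h
    by_cases hex : ∃ i₁ : Fin m, ν = -((N * b i₁ : ℕ) : ℤ)
    · obtain ⟨i₁, hi₁⟩ := hex
      refine ⟨i₁, fun i hi => (h i).resolve_right fun h' => hi (hb (Nat.eq_of_mul_eq_mul_left hN ?_))⟩
      have h'' : ((N * b i : ℕ) : ℤ) = ((N * b i₁ : ℕ) : ℤ) := neg_inj.mp (h'.symm.trans hi₁)
      exact_mod_cast h''
    · exact ⟨⟨0, hm⟩, fun i _ => (h i).resolve_right fun h' => hex ⟨i, h'⟩⟩
  -- the pole direction `z` and a coordinate `j₀` with `z j₀ ≠ 0`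
  set z : Fin s → ℂ := fun j => (p j).coeff μ
  obtain ⟨j₀, hj₀⟩ : ∃ j₀, z j₀ ≠ 0 := Function.ne_iff.mp hz
  -- `Λ = z_{j₀}⁻¹ p_{j₀}`: no coefficients below `μ`, coefficient `1` at `μ`, order `μ`
  set Λ : LaurentSeries ℂ := (z j₀)⁻¹ • p j₀ with hΛdef
  have hΛcoeff : ∀ g, Λ.coeff g = (z j₀)⁻¹ * (p j₀).coeff g := fun g => by
    rw [hΛdef, HahnSeries.coeff_smul, smul_eq_mul]
  have hΛvan : ∀ g < μ, Λ.coeff g = 0 := fun g hg => by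
    rw [hΛcoeff, hp j₀ g hg, mul_zero]
  have hΛμ : Λ.coeff μ = 1 := by
    rw [hΛcoeff]
    exact inv_mul_cancel₀ hj₀
  have hΛne : Λ ≠ 0 := by
    intro h
    have h1 := hΛμ
    rw [h, HahnSeries.coeff_zero] at h1
    exact zero_ne_one h1
  have hΛord : Λ.order = μ := by
    refine le_antisymm (HahnSeries.order_le_of_coeff_ne_zero (by rw [hΛμ]; exact one_ne_zero)) ?_
    by_contra h
    exact (HahnSeries.coeff_order_eq_zero.not.mpr hΛne) (hΛvan _ (not_le.mp h))
  -- `Λ⁻¹`: no coefficients below `-μ`, coefficient `1` at `-μ`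
  have hw₀Λ : Λ⁻¹ * Λ = 1 := inv_mul_cancel₀ hΛne
  have hw₀ord : Λ⁻¹.order = -μ := by
    have h := HahnSeries.order_mul (inv_ne_zero hΛne) hΛne
    rw [hw₀Λ, HahnSeries.order_one, hΛord] at h
    omega
  have hw₀van : ∀ g < -μ, Λ⁻¹.coeff g = 0 := fun g hg =>
    HahnSeries.coeff_eq_zero_of_lt_order (by rwa [hw₀ord])
  have hw₀lead : Λ⁻¹.coeff (-μ) = 1 := by
    have h := PolarPeeling.coeff_mul_eq hw₀van hΛvan
    rw [hw₀Λ, neg_add_cancel, HahnSeries.coeff_one, if_pos rfl, hΛμ, mul_one] at h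
    exact h.symm
  -- the chart at infinity: `q j = Λ⁻¹ p j`, `p j = Λ q j`, `(q j)(0) = z j`, `q j₀ = z j₀`
  set q : Fin s → LaurentSeries ℂ := fun j => Λ⁻¹ * p j with hqdef
  have hpq : p = fun j => Λ * q j := by
    funext j
    simp only [hqdef]
    rw [← mul_assoc, mul_inv_cancel₀ hΛne, one_mul]
  have hqvan : ∀ j, ∀ g < 0, (q j).coeff g = 0 := fun j g hg =>
    PolarPeeling.coeff_mul_eq_zero_of_lt hw₀van (hp j) g (by omega)
  have hq0 : ∀ j, (q j).coeff 0 = z j := fun j => by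
    have h := PolarPeeling.coeff_mul_eq hw₀van (hp j)
    rw [neg_add_cancel, hw₀lead, one_mul] at h
    exact h
  have hqj₀ : q j₀ = HahnSeries.C (z j₀) := by
    have h1 : p j₀ = HahnSeries.C (z j₀) * Λ := by
      rw [HahnSeries.C_mul_eq_smul, hΛdef, smul_inv_smul₀ hj₀]
    show Λ⁻¹ * p j₀ = _
    rw [h1, mul_left_comm, hw₀Λ, mul_one]
  -- the local coordinates `w j = q j - z j` of positive order, `w j₀ = 0`
  set w : Fin s → LaurentSeries ℂ := fun j => q j - HahnSeries.C (z j) with hwdef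
  have hwvan : ∀ j, ∀ g < 1, (w j).coeff g = 0 := by
    intro j g hg
    simp only [hwdef, HahnSeries.coeff_sub, HahnSeries.C_apply, HahnSeries.coeff_single]
    rcases lt_or_eq_of_le (show g ≤ 0 by omega) with hg | rfl
    · rw [hqvan j g hg, if_neg hg.ne, sub_zero]
    · rw [if_pos rfl, hq0, sub_self]
  have hw₀ : w j₀ = 0 := by
    simp only [hwdef, hqj₀, sub_self]
  -- `o ≥ 1`: the least exponent carrying a nonzero coefficient of some `w j`, capped at `-μ`
  obtain ⟨o, hoP, homin⟩ := Int.exists_least_of_bdd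
    (P := fun g => (∃ j, (w j).coeff g ≠ 0) ∨ g = -μ)
    ⟨1, fun g hg => by
      by_contra h
      rcases hg with ⟨j, hj⟩ | hg
      · exact hj (hwvan j g (by omega))
      · omega⟩
    ⟨-μ, Or.inr rfl⟩
  have ho : 0 < o := by
    by_contra h
    rcases hoP with ⟨j, hj⟩ | hg
    · exact hj (hwvan j o (by omega))
    · omega
  have hoμ : o ≤ -μ := homin _ (Or.inr rfl)
  have hbelow : ∀ j, ∀ g < o, (w j).coeff g = 0 := fun j g hg => by
    by_contra h
    exact absurd (homin g (Or.inl ⟨j, h⟩)) (not_le.mpr hg)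
  -- the jets `q j = z j + v j t^o`, `v j = (w j).coeff o`
  have hjq : ∀ j, ∀ g ≤ o, (q j).coeff g =
      (if g = 0 then z j else 0) + if g = o then (w j).coeff o else 0 := fun j => by
    refine PolarImmersive.jet_congr (PolarImmersive.jet_add (PolarImmersive.jet_C o (z j))
      (PolarImmersive.jet_of_coeff_eq_zero (hbelow j))) ?_ (add_zero _) (zero_add _)
    simp only [hwdef]
    ring
  -- the outputs in the chart and their lowest orders
  have hsol' : ∀ i, MvPolynomial.aeval (fun j => Λ * q j) (Γ i) =
      HahnSeries.single (-((N * a i : ℕ) : ℤ)) (1 : ℂ) +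
        HahnSeries.single (-((N * b i : ℕ) : ℤ)) (1 : ℂ) := by
    intro i
    have h := hsol i
    rw [hpq] at h
    exact h
  have key := fun i => InfinityStepTwo.coeff_aeval_of_jet ho hoμ Λ hΛvan hΛμ q z
    (fun j => (w j).coeff o) hjq (Γ i) (hΓ i) (hBz i)
  rcases hoμ.lt_or_eq with hlt | heq
  · -- `o < -μ` (the remainder has a pole): the direction `v ∉ ℂ z`, first disjunct
    left
    have hcmp : ∀ i,
        (∑ j, (w j).coeff o * MvPolynomial.eval z
          (MvPolynomial.pderiv j (MvPolynomial.homogeneousComponent 2 (Γ i))) = 0 ∨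
          μ + μ + o = -((N * b i : ℕ) : ℤ)) := fun i =>
      (InfinityCommonZero.le_and_eq_zero_or_eq (huv i) (hsol' i) (key i).1 ((key i).2 hlt)).2
    have hv : ∀ c : ℂ, (fun j => (w j).coeff o) ≠ c • z := by
      intro c hc
      rcases hoP with ⟨j, hj⟩ | hg
      · have hc₀ := congr_fun hc j₀
        simp only [Pi.smul_apply, smul_eq_mul] at hc₀
        rw [hw₀, HahnSeries.coeff_zero] at hc₀
        have hc0 : c = 0 := by
          rcases mul_eq_zero.mp hc₀.symm with h | h
          · exact h
          · exact absurd h hj₀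
        have hcj := congr_fun hc j
        simp only [Pi.smul_apply, smul_eq_mul, hc0, zero_mul] at hcj
        exact hj hcj
      · exact absurd hg hlt.ne
    obtain ⟨i₁, hi₁⟩ := hsel _ _ hcmp
    exact ⟨fun j => (w j).coeff o, hv, i₁, hi₁⟩
  · -- `o = -μ` (the remainder is integral, with value `v`): second disjunct with `w = v`
    right
    have hcmp : ∀ i,
        (MvPolynomial.eval z (MvPolynomial.homogeneousComponent 1 (Γ i)) +
          ∑ j, (w j).coeff o * MvPolynomial.eval z
            (MvPolynomial.pderiv j (MvPolynomial.homogeneousComponent 2 (Γ i))) = 0 ∨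
          μ = -((N * b i : ℕ) : ℤ)) := fun i =>
      (InfinityCommonZero.le_and_eq_zero_or_eq (huv i) (hsol' i)
        (fun g hg => (key i).1 g (by omega))
        (coeff_aeval_of_jet_top ho heq Λ hΛvan hΛμ q z (fun j => (w j).coeff o) hjq (Γ i) (hΓ i)
          (hBz i))).2
    obtain ⟨i₁, hi₁⟩ := hsel _ _ hcmp
    refine ⟨fun j => (w j).coeff o, i₁, fun i hi => ?_⟩
    rw [sum_mul_eval_pderiv_eq (Γ i) (hΓ i)]
    exact hi₁ i hi

end Summit.ValiantsHypothesis.ValiantsHypothesis.Theorems.BinomialCandidateStubs
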